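import Summits.Parity.BatemanHorn.Theorems.AlmostPrimeZerosSystemMomentDeficitAssemblyCore
import Literature.NumberTheory.LFunctions.MertensElementary

/-!
# Crux `SystemMomentDeficit` (stmt-Parity-11326), line `Ideator3Sketch`: the assembly (registered stub)

`stub_assembly` of the skeleton `Cruxes/SystemMomentDeficit/Lines/Ideator3Sketch.lean`: from the
prime-pair tail, the Mertens window, the termwise near-pair covariance bound, the pair bookkeeping
and the decorrelated covariance bound (all taken as hypotheses, verbatim the registered stub
statements) to the moment-deficit bound `E s_f − Var s_f ≤ C` for `x ≥ 256`, for every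
Bateman–Horn system `f`.

Proof layout.  Constants: `D = Σᵢ deg fᵢ · Mᵢ` (Hensel–Nagell root bounds,
`exists_rootCount_primePow_le`), `K = Σᵢ 2(deg fᵢ + H(fᵢ))` (rough-count bound),
`c_W = 3 + |C_W|` (Mertens windows at `(⌊√x⌋, x]` and `(⌊x^{1/4}⌋, ⌊√x⌋]`),
`C_pS = Σ_{i,j} max(C_{ij}, 0)` (near-pair constants).  At `x`: `z = ⌊√x⌋`, `y = ⌊√z⌋`, the
harmonic sums over `PP(x) ∖ PP(z)`, `PP(z) ∖ PP(y)` and the log-mass over `PP(y)` (Mertens I), the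
indicator family `Zf (i, q)`, the root-class bound and the near-pair bound in `Zf`-form, the two
pair blocks of part 2, and then `assembly_core` of part 3.

Notation (docstrings only).  `Y = x + 1`, `E g = Y⁻¹ Σ_{0 ≤ n ≤ x} g(n)`, `PP(z)` = primes `≤ z` ∪
prime squares `≤ z`.
-/

namespace Summit.Parity.BatemanHorn.Cruxes.SystemMomentDeficit.Ideator3Sketch

open scoped BigOperators
open Finset Polynomial
open Literature.NumberTheory.Sieve
open Summit.Parity.BatemanHorn.Theorems.AlmostPrimeZeros.SystemMertens


/-- From a bound beyond a threshold to a bound for all `x ≥ 2`: the finitely many values below the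
threshold are absorbed into the constant. [folklore] -/
theorem exists_forall_ge_two_of_threshold {D : ℕ → ℝ} {x₀ : ℕ} {C : ℝ}
    (h : ∀ x : ℕ, x₀ ≤ x → D x ≤ C) : ∃ C' : ℝ, ∀ x : ℕ, 2 ≤ x → D x ≤ C' := by
  refine ⟨max C (∑ x ∈ Finset.range x₀, |D x|), fun x _ => ?_⟩
  by_cases hx : x₀ ≤ x
  · exact (h x hx).trans (le_max_left _ _)
  · refine le_trans ?_ (le_max_right _ _)
    have hmem : x ∈ Finset.range x₀ := Finset.mem_range.2 (not_le.1 hx)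
    exact (le_abs_self (D x)).trans
      (Finset.single_le_sum (f := fun x => |D x|) (fun _ _ => abs_nonneg _) hmem)

/-- **The assembly for one system** (`f`-local form of the registered stub `stub_assembly`): the
four elementary stubs (prime-pair tail, Mertens window, near-pair covariance, pair bookkeeping)
and the decorrelated covariance bound FOR THIS SYSTEM `f` give `E s_f − Var s_f ≤ C` for
`x ≥ 256`.  (Used with K1 proved for special systems, e.g. all-linear ones.) -/
theorem assembly_local :
    (∃ C : ℝ, ∀ x : ℕ, 2 ≤ x →
      ∑ q ∈ Nat.primesLE (Nat.sqrt x) ∪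
          ((Nat.primesLE (Nat.sqrt x)).filter (fun p => p ^ 2 ≤ Nat.sqrt x)).image (fun p => p ^ 2),
        ∑ q' ∈ (Nat.primesLE x ∪ ((Nat.primesLE x).filter (fun p => p ^ 2 ≤ x)).image (fun p => p ^ 2)).filter
            (fun q' => x < q * q'),
          (1 : ℝ) / ((q : ℝ) * (q' : ℝ)) ≤ C) →
    (∃ C : ℝ, ∀ t x : ℕ, 2 ≤ t → t ≤ x →
      ∑ p ∈ (Nat.primesLE x).filter (fun p => t < p), (1 : ℝ) / (p : ℝ) ≤
        (Real.log x - Real.log t + C) / Real.log t) →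
    (∀ (g₁ g₂ : ℤ[X]), Irreducible g₁ → 0 < g₁.natDegree → 0 < g₁.leadingCoeff →
      Irreducible g₂ → 0 < g₂.natDegree → 0 < g₂.leadingCoeff →
      ∃ C : ℝ, ∀ (x q₁ q₂ : ℕ), IsPrimePow q₁ → IsPrimePow q₂ → Nat.Coprime q₁ q₂ →
        (#((Finset.range (x + 1)).filter fun n : ℕ =>
              q₁ ∣ (g₁.eval (n : ℤ)).toNat ∧ (g₁.eval (n : ℤ)).toNat ≠ 0) : ℝ) / ((x : ℝ) + 1) *
            ((#((Finset.range (x + 1)).filter fun n : ℕ =>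
              q₂ ∣ (g₂.eval (n : ℤ)).toNat ∧ (g₂.eval (n : ℤ)).toNat ≠ 0) : ℝ) / ((x : ℝ) + 1)) -
          (#((Finset.range (x + 1)).filter fun n : ℕ =>
              (q₁ ∣ (g₁.eval (n : ℤ)).toNat ∧ (g₁.eval (n : ℤ)).toNat ≠ 0) ∧
                (q₂ ∣ (g₂.eval (n : ℤ)).toNat ∧ (g₂.eval (n : ℤ)).toNat ≠ 0)) : ℝ) / ((x : ℝ) + 1) ≤
          C / ((x : ℝ) + 1)) →
    (∀ x : ℕ,
      #(((Nat.primesLE x ∪ ((Nat.primesLE x).filter (fun p => p ^ 2 ≤ x)).image (fun p => p ^ 2)) ×ˢ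
            (Nat.primesLE x ∪ ((Nat.primesLE x).filter (fun p => p ^ 2 ≤ x)).image (fun p => p ^ 2))).filter
          (fun qq : ℕ × ℕ => Nat.Coprime qq.1 qq.2 ∧ qq.1 * qq.2 ≤ x)) ≤ 2 * (x + 1) ∧
      ∑ qq ∈ ((Nat.primesLE x ∪ ((Nat.primesLE x).filter (fun p => p ^ 2 ≤ x)).image (fun p => p ^ 2)) ×ˢ
            (Nat.primesLE x ∪ ((Nat.primesLE x).filter (fun p => p ^ 2 ≤ x)).image (fun p => p ^ 2))).filter
          (fun qq : ℕ × ℕ => ¬ Nat.Coprime qq.1 qq.2),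
        (1 : ℝ) / ((qq.1 : ℝ) * (qq.2 : ℝ)) ≤ 8) →
    ∀ (k : ℕ) (f : Fin k → ℤ[X]), IsBatemanHornSystem f →
      (∃ C : ℝ, ∀ x : ℕ, 16 ≤ x →
      -C ≤
        (∑ n ∈ Finset.range (x + 1),
            (∑ i, ∑ q ∈ (Nat.primesLE (Nat.sqrt (Nat.sqrt x)) ∪
                ((Nat.primesLE (Nat.sqrt (Nat.sqrt x))).filter
                  (fun p => p ^ 2 ≤ Nat.sqrt (Nat.sqrt x))).image (fun p => p ^ 2)).filter
                (fun q => q ∣ ((f i).eval (n : ℤ)).toNat ∧ ((f i).eval (n : ℤ)).toNat ≠ 0),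
              (1 - 2 * ArithmeticFunction.vonMangoldt q / Real.log (Nat.sqrt (Nat.sqrt x)))) *
            (((∑ i, (((f i).eval (n : ℤ)).toNat.factorization.sum fun _ v => min v 2) : ℕ) : ℝ) -
              ((∑ i, #((Nat.primesLE x ∪ ((Nat.primesLE x).filter (fun p => p ^ 2 ≤ x)).image
                  (fun p => p ^ 2)).filter
                (fun q => q ∣ ((f i).eval (n : ℤ)).toNat ∧ ((f i).eval (n : ℤ)).toNat ≠ 0)) : ℕ) : ℝ))) /
            ((x : ℝ) + 1) -
          (∑ n ∈ Finset.range (x + 1),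
              (∑ i, ∑ q ∈ (Nat.primesLE (Nat.sqrt (Nat.sqrt x)) ∪
                  ((Nat.primesLE (Nat.sqrt (Nat.sqrt x))).filter
                    (fun p => p ^ 2 ≤ Nat.sqrt (Nat.sqrt x))).image (fun p => p ^ 2)).filter
                  (fun q => q ∣ ((f i).eval (n : ℤ)).toNat ∧ ((f i).eval (n : ℤ)).toNat ≠ 0),
                (1 - 2 * ArithmeticFunction.vonMangoldt q / Real.log (Nat.sqrt (Nat.sqrt x))))) /
              ((x : ℝ) + 1) *
            ((∑ n ∈ Finset.range (x + 1),
                (((∑ i, (((f i).eval (n : ℤ)).toNat.factorization.sum fun _ v => min v 2) : ℕ) : ℝ) -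
                  ((∑ i, #((Nat.primesLE x ∪ ((Nat.primesLE x).filter (fun p => p ^ 2 ≤ x)).image
                      (fun p => p ^ 2)).filter
                    (fun q => q ∣ ((f i).eval (n : ℤ)).toNat ∧ ((f i).eval (n : ℤ)).toNat ≠ 0)) : ℕ) :
                    ℝ))) /
              ((x : ℝ) + 1))) →
      ∃ C : ℝ, ∀ x : ℕ, 256 ≤ x →
      ((∑ n ∈ Finset.range (x + 1), ∑ i, (((f i).eval (n : ℤ)).toNat.factorization.sum
          fun _ v => min v 2) : ℕ) : ℝ) / ((x : ℝ) + 1) -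
        (((∑ n ∈ Finset.range (x + 1), (∑ i, (((f i).eval (n : ℤ)).toNat.factorization.sum
            fun _ v => min v 2)) ^ 2 : ℕ) : ℝ) / ((x : ℝ) + 1) -
          (((∑ n ∈ Finset.range (x + 1), ∑ i, (((f i).eval (n : ℤ)).toNat.factorization.sum
              fun _ v => min v 2) : ℕ) : ℝ) / ((x : ℝ) + 1)) ^ 2) ≤ C := by
  intro hS2 hS2' hS3a hS3c k f hf hK1f
  classical
  /- ### constants (independent of `x`) -/
  obtain ⟨C2, hC2⟩ := hS2
  obtain ⟨CW, hCW⟩ := hS2'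
  choose Cp hCp using fun i j => hS3a (f i) (f j) (hf.irreducible i) (hf.natDegree_pos i)
    (hf.leadingCoeff_pos i) (hf.irreducible j) (hf.natDegree_pos j) (hf.leadingCoeff_pos j)
  obtain ⟨CK, hCK⟩ := hK1f
  choose M hM1 hM hρ using fun i => exists_rootCount_primePow_le (hf.irreducible i) (hf.natDegree_pos i)
  set D : ℝ := ∑ i, ((f i).natDegree : ℝ) * (M i : ℝ) with hD
  set K : ℝ := ∑ i, (2 * (((f i).natDegree : ℝ) +
    ((∑ j ∈ range ((f i).natDegree + 1), ((f i).coeff j).natAbs : ℕ) : ℝ))) with hK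
  set cW : ℝ := 3 + |CW| with hcW
  set CpS : ℝ := ∑ i, ∑ j, max (Cp i j) 0 with hCpS
  have hD0 : 0 ≤ D := sum_nonneg fun i _ => by positivity
  have hK0 : 0 ≤ K := sum_nonneg fun i _ => by positivity
  have hCpS0 : 0 ≤ CpS := sum_nonneg fun i _ => sum_nonneg fun j _ => le_max_right _ _
  have hCp_le : ∀ i j, Cp i j ≤ CpS := fun i j =>
    (le_max_left _ _).trans
      ((single_le_sum (f := fun j => max (Cp i j) 0) (fun j _ => le_max_right _ _) (mem_univ j)).trans
        (single_le_sum (f := fun i => ∑ j, max (Cp i j) 0)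
          (fun i _ => sum_nonneg fun j _ => le_max_right _ _) (mem_univ i)))
  refine ⟨((k : ℝ) ^ 2 * (2 * CpS + 32 * D ^ 2)) + (2 * k * D * (cW + 1) + K) +
      2 * ((k : ℝ) ^ 2 * (2 * CpS + 4 * D ^ 2 * (8 + |C2|))) +
      2 * (2 * k * D * (cW + 1) * K + 16 * k * D * K + |CK|), fun x hx => ?_⟩
  /- ### parameters at `x` -/
  set z : ℕ := Nat.sqrt x with hz
  set y : ℕ := Nat.sqrt z with hy
  have hx1 : 1 ≤ x := by omega
  have hx2 : 2 ≤ x := by omega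
  have hx16 : 16 ≤ x := by omega
  have hz16 : 16 ≤ z := Nat.le_sqrt.2 (by omega)
  have hy4 : 4 ≤ y := Nat.le_sqrt.2 (by omega)
  have hzx : z ≤ x := Nat.sqrt_le_self x
  have hyz : y ≤ z := Nat.sqrt_le_self z
  have hzz : z * z ≤ x := Nat.sqrt_le x
  have hY0 : (0 : ℝ) < (x : ℝ) + 1 := by positivity
  -- logarithms
  have hlog4 : (1 : ℝ) ≤ Real.log 4 := by
    rw [Real.le_log_iff_exp_le (by norm_num)]
    have := Real.exp_one_lt_d9
    linarith
  have hlogy : 1 ≤ Real.log y := hlog4.trans (Real.log_le_log (by norm_num) (by exact_mod_cast hy4))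
  have hlogz : 1 ≤ Real.log z := hlog4.trans (Real.log_le_log (by norm_num) (by
    have : (16 : ℝ) ≤ z := by exact_mod_cast hz16
    linarith))
  have hlogy0 : 0 < Real.log y := by linarith
  have hlogz0 : 0 < Real.log z := by linarith
  have hlogxz : Real.log x ≤ 2 * Real.log z + 2 := log_le_two_mul_log_sqrt_add_two hx1
  have hlogzy : Real.log z ≤ 2 * Real.log y + 2 := log_le_two_mul_log_sqrt_add_two (by omega)
  -- the two Mertens windows
  have hwin1 : ∑ p ∈ (Nat.primesLE x).filter (fun p => z < p), (1 : ℝ) / (p : ℝ) ≤ cW := by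
    refine (hCW z x (by omega) hzx).trans ?_
    rw [div_le_iff₀ hlogz0, hcW]
    have h1 : CW ≤ |CW| := le_abs_self CW
    have h2 : |CW| * 1 ≤ |CW| * Real.log z := mul_le_mul_of_nonneg_left hlogz (abs_nonneg CW)
    nlinarith
  have hwin2 : ∑ p ∈ (Nat.primesLE z).filter (fun p => y < p), (1 : ℝ) / (p : ℝ) ≤ cW := by
    refine (hCW y z (by omega) hyz).trans ?_
    rw [div_le_iff₀ hlogy0, hcW]
    have h1 : CW ≤ |CW| := le_abs_self CW
    have h2 : |CW| * 1 ≤ |CW| * Real.log y := mul_le_mul_of_nonneg_left hlogy (abs_nonneg CW)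
    nlinarith
  have hsum1 : ∑ q ∈ (Nat.primesLE x ∪ ((Nat.primesLE x).filter (fun p => p ^ 2 ≤ x)).image (fun p => p ^ 2)) \ (Nat.primesLE z ∪ ((Nat.primesLE z).filter (fun p => p ^ 2 ≤ z)).image (fun p => p ^ 2)), (1 : ℝ) / (q : ℝ) ≤ cW + 1 := by
    refine (sum_PP_sdiff_le (g := fun q : ℕ => (1 : ℝ) / (q : ℝ)) fun q => by positivity).trans ?_
    push_cast
    linarith [hwin1, sum_primesLE_sq_inv_le_one x]
  have hsum2 : ∑ q ∈ (Nat.primesLE z ∪ ((Nat.primesLE z).filter (fun p => p ^ 2 ≤ z)).image (fun p => p ^ 2)) \ (Nat.primesLE y ∪ ((Nat.primesLE y).filter (fun p => p ^ 2 ≤ y)).image (fun p => p ^ 2)), (1 : ℝ) / (q : ℝ) ≤ cW + 1 := by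
    refine (sum_PP_sdiff_le (g := fun q : ℕ => (1 : ℝ) / (q : ℝ)) fun q => by positivity).trans ?_
    push_cast
    linarith [hwin2, sum_primesLE_sq_inv_le_one z]
  have hsum3 : ∑ q ∈ (Nat.primesLE y ∪ ((Nat.primesLE y).filter (fun p => p ^ 2 ≤ y)).image (fun p => p ^ 2)), ArithmeticFunction.vonMangoldt q / (q : ℝ) ≤ 2 * Real.log y + 2 := by
    refine (sum_PP_le (g := fun q : ℕ => ArithmeticFunction.vonMangoldt q / (q : ℝ)) fun q =>
      div_nonneg ArithmeticFunction.vonMangoldt_nonneg (Nat.cast_nonneg _)).trans ?_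
    have h1 : ∑ p ∈ Nat.primesLE y, ArithmeticFunction.vonMangoldt p / (p : ℝ) ≤ Real.log y + 2 := by
      calc ∑ p ∈ Nat.primesLE y, ArithmeticFunction.vonMangoldt p / (p : ℝ)
          = ∑ p ∈ Nat.primesLE y, Real.log p / p :=
            sum_congr rfl fun p hp => by
              rw [ArithmeticFunction.vonMangoldt_apply_prime (Nat.mem_primesLE.1 hp).2]
        _ ≤ Real.log y + Real.log 4 := Literature.NumberTheory.LFunctions.MertensBound.sum_log_div_prime_le y
        _ ≤ Real.log y + 2 := by
            have h2 : Real.log 2 ≤ 1 := by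
              have := Real.log_two_lt_d9; linarith
            have h4 : Real.log 4 = 2 * Real.log 2 := by
              rw [show (4 : ℝ) = 2 ^ 2 by norm_num, Real.log_pow]; push_cast; ring
            linarith
    have h2 : ∑ p ∈ (Nat.primesLE y).filter (fun p => p ^ 2 ≤ y),
        ArithmeticFunction.vonMangoldt (p ^ 2) / ((p ^ 2 : ℕ) : ℝ) ≤ Real.log y := by
      calc ∑ p ∈ (Nat.primesLE y).filter (fun p => p ^ 2 ≤ y),
            ArithmeticFunction.vonMangoldt (p ^ 2) / ((p ^ 2 : ℕ) : ℝ)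
          ≤ ∑ p ∈ (Nat.primesLE y).filter (fun p => p ^ 2 ≤ y), Real.log y * (1 / ((p : ℝ) ^ 2)) := by
            refine sum_le_sum fun p hp0 => ?_
            have hp := (Nat.mem_primesLE.1 (mem_filter.1 hp0).1)
            rw [ArithmeticFunction.vonMangoldt_apply_pow two_ne_zero,
              ArithmeticFunction.vonMangoldt_apply_prime hp.2]
            push_cast
            rw [div_eq_mul_one_div]
            have hple : (p : ℝ) ≤ y := by exact_mod_cast hp.1
            exact mul_le_mul_of_nonneg_right
              (Real.log_le_log (by exact_mod_cast hp.2.pos) hple) (by positivity)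
        _ = Real.log y * ∑ p ∈ (Nat.primesLE y).filter (fun p => p ^ 2 ≤ y), 1 / ((p : ℝ) ^ 2) := by
            rw [mul_sum]
        _ ≤ Real.log y * 1 := by gcongr; exact sum_primesLE_sq_inv_le_one y
        _ = Real.log y := mul_one _
    linarith
  /- ### the indicators `Zf (i, q)` and their means -/
  set Zf : Fin k × ℕ → ℕ → ℝ := fun t n =>
    if t.2 ∣ ((f t.1).eval (n : ℤ)).toNat ∧ ((f t.1).eval (n : ℤ)).toNat ≠ 0 then 1 else 0 with hZf
  have hZf01 : ∀ t n, Zf t n = 0 ∨ Zf t n = 1 := fun t n => by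
    simp only [hZf]; split_ifs <;> simp
  have hZf0 : ∀ t n, 0 ≤ Zf t n := fun t n => by rcases hZf01 t n with h | h <;> simp [h]
  have hZsum : ∀ t, ∑ n ∈ range (x + 1), Zf t n =
      (#((range (x + 1)).filter fun n : ℕ =>
        t.2 ∣ ((f t.1).eval (n : ℤ)).toNat ∧ ((f t.1).eval (n : ℤ)).toNat ≠ 0) : ℝ) := fun t => by
    simp only [hZf]
    rw [sum_boole]
  have hZsum2 : ∀ t t', ∑ n ∈ range (x + 1), Zf t n * Zf t' n =
      (#((range (x + 1)).filter fun n : ℕ =>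
        (t.2 ∣ ((f t.1).eval (n : ℤ)).toNat ∧ ((f t.1).eval (n : ℤ)).toNat ≠ 0) ∧
          (t'.2 ∣ ((f t'.1).eval (n : ℤ)).toNat ∧ ((f t'.1).eval (n : ℤ)).toNat ≠ 0)) : ℝ) := by
    intro t t'
    simp only [hZf, ite_one_zero_mul_ite]
    rw [sum_boole]
  have hZcard : ∀ (i : Fin k) (S : Finset ℕ) (n : ℕ), ∑ q ∈ S, Zf (i, q) n =
      (#(S.filter (fun q => q ∣ ((f i).eval (n : ℤ)).toNat ∧ ((f i).eval (n : ℤ)).toNat ≠ 0)) : ℝ) := by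
    intro i S n
    simp only [hZf]
    rw [sum_boole]
  -- root-class bound for the means: `E 1_{i,q} ≤ 2D/q` for `q ∈ PP(x)`
  have he : ∀ t : Fin k × ℕ, t.2 ∈ (Nat.primesLE x ∪ ((Nat.primesLE x).filter (fun p => p ^ 2 ≤ x)).image (fun p => p ^ 2)) →
      (∑ n ∈ range (x + 1), Zf t n) / ((x : ℝ) + 1) ≤ 2 * D / (t.2 : ℝ) := by
    rintro ⟨i, q⟩ hq
    obtain ⟨hpp, hq2, hqx⟩ := isPrimePow_and_le_of_mem_PP hq
    have hq0 : 0 < q := by omega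
    have hqR : (0 : ℝ) < q := by exact_mod_cast hq0
    rw [hZsum]
    refine (card_filter_dvd_toNat_div_le (f i) hq0 x).trans ?_
    obtain ⟨p, a, hp, ha, rfl⟩ := (isPrimePow_nat_iff q).1 hpp
    have hρD : (polyRootCountMod ![f i] (p ^ a) : ℝ) ≤ D := by
      have h1 : (polyRootCountMod ![f i] (p ^ a) : ℝ) ≤ ((f i).natDegree : ℝ) * (M i : ℝ) := by
        exact_mod_cast hM i p hp a
      exact h1.trans (single_le_sum (f := fun i => ((f i).natDegree : ℝ) * (M i : ℝ))
        (fun i _ => by positivity) (mem_univ i))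
    have hY' : 1 / ((x : ℝ) + 1) ≤ 1 / ((p ^ a : ℕ) : ℝ) :=
      one_div_le_one_div_of_le hqR (by exact_mod_cast Nat.le_succ_of_le hqx)
    calc (polyRootCountMod ![f i] (p ^ a) : ℝ) * (1 / ((p ^ a : ℕ) : ℝ) + 1 / ((x : ℝ) + 1))
        ≤ D * (1 / ((p ^ a : ℕ) : ℝ) + 1 / ((x : ℝ) + 1)) :=
          mul_le_mul_of_nonneg_right hρD (by positivity)
      _ ≤ D * (1 / ((p ^ a : ℕ) : ℝ) + 1 / ((p ^ a : ℕ) : ℝ)) :=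
          mul_le_mul_of_nonneg_left (add_le_add_right hY' _) hD0
      _ = 2 * D / ((p ^ a : ℕ) : ℝ) := by ring
  -- the near-pair covariance bound in `Zf`-form
  have hpair : ∀ t t' : Fin k × ℕ, t.2 ∈ (Nat.primesLE x ∪ ((Nat.primesLE x).filter (fun p => p ^ 2 ≤ x)).image (fun p => p ^ 2)) → t'.2 ∈ (Nat.primesLE x ∪ ((Nat.primesLE x).filter (fun p => p ^ 2 ≤ x)).image (fun p => p ^ 2)) → Nat.Coprime t.2 t'.2 →
      (∑ n ∈ range (x + 1), Zf t n) / ((x : ℝ) + 1) * ((∑ n ∈ range (x + 1), Zf t' n) / ((x : ℝ) + 1)) -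
        (∑ n ∈ range (x + 1), Zf t n * Zf t' n) / ((x : ℝ) + 1) ≤ CpS / ((x : ℝ) + 1) := by
    rintro ⟨i, q⟩ ⟨j, q'⟩ hq hq' hcop
    rw [hZsum, hZsum, hZsum2]
    exact (hCp i j x q q' (isPrimePow_and_le_of_mem_PP hq).1 (isPrimePow_and_le_of_mem_PP hq').1
      hcop).trans (div_le_div_of_nonneg_right (hCp_le i j) hY0.le)
  /- ### the two pair blocks (applied while `PP` is visible), then `PP(x), PP(z), PP(y)` frozen -/
  have hFa0 := ablock_le k Zf x z D CpS hD0 hCpS0 hzx hzz hZf01 he hpair (hS3c x).1 (hS3c x).2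
  have hC2x : ∑ q ∈ (Nat.primesLE z ∪ ((Nat.primesLE z).filter (fun p => p ^ 2 ≤ z)).image (fun p => p ^ 2)), ∑ q' ∈ ((Nat.primesLE x ∪ ((Nat.primesLE x).filter (fun p => p ^ 2 ≤ x)).image (fun p => p ^ 2))).filter (fun q' => x < q * q'),
      (1 : ℝ) / ((q : ℝ) * (q' : ℝ)) ≤ |C2| := (hC2 x hx2).trans (le_abs_self C2)
  have hcovU0 := covU_ge Zf x z D CpS |C2| hD0 hCpS0 hzx hZf01 he hpair (hS3c x).1 (hS3c x).2 hC2x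
  have hCKx := hCK x hx16
  have hcapx : ∀ m : ℕ, #(((Nat.primesLE x ∪ ((Nat.primesLE x).filter (fun p => p ^ 2 ≤ x)).image (fun p => p ^ 2))).filter (fun q => q ∣ m ∧ m ≠ 0)) ≤
      (m.factorization.sum fun _ v => min v 2) := card_PP_filter_le_capped x
  have hcapx' : ∀ n : ℕ, n ≤ x → ∀ i : Fin k,
      (((f i).eval (n : ℤ)).toNat.factorization.sum fun _ v => min v 2) ≤
        #(((Nat.primesLE x ∪ ((Nat.primesLE x).filter (fun p => p ^ 2 ≤ x)).image (fun p => p ^ 2))).filter (fun q => q ∣ ((f i).eval (n : ℤ)).toNat ∧ ((f i).eval (n : ℤ)).toNat ≠ 0)) +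
          2 * ((f i).natDegree + ∑ j ∈ range ((f i).natDegree + 1), ((f i).coeff j).natAbs) :=
    fun n hn i => capped_le_card_PP_filter_add (f i) hx1 hn
  have hPyz : (Nat.primesLE y ∪ ((Nat.primesLE y).filter (fun p => p ^ 2 ≤ y)).image (fun p => p ^ 2)) ⊆ (Nat.primesLE z ∪ ((Nat.primesLE z).filter (fun p => p ^ 2 ≤ z)).image (fun p => p ^ 2)) := PP_mono hyz
  have hPzx : (Nat.primesLE z ∪ ((Nat.primesLE z).filter (fun p => p ^ 2 ≤ z)).image (fun p => p ^ 2)) ⊆ (Nat.primesLE x ∪ ((Nat.primesLE x).filter (fun p => p ^ 2 ≤ x)).image (fun p => p ^ 2)) := PP_mono hzx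
  set Px : Finset ℕ := (Nat.primesLE x ∪ ((Nat.primesLE x).filter (fun p => p ^ 2 ≤ x)).image (fun p => p ^ 2)) with hPx
  set Pz : Finset ℕ := (Nat.primesLE z ∪ ((Nat.primesLE z).filter (fun p => p ^ 2 ≤ z)).image (fun p => p ^ 2)) with hPz
  set Py : Finset ℕ := (Nat.primesLE y ∪ ((Nat.primesLE y).filter (fun p => p ^ 2 ≤ y)).image (fun p => p ^ 2)) with hPy
  clear_value Px Pz Py
  have hZfdef : ∀ t n, Zf t n =
      if t.2 ∣ ((f t.1).eval (n : ℤ)).toNat ∧ ((f t.1).eval (n : ℤ)).toNat ≠ 0 then 1 else 0 :=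
    fun t n => by rw [hZf]
  exact assembly_core k f x y Px Pz Py Zf D K CpS cW |C2| CK hx1 hD0 hK0 hlogy hPyz hPzx hZfdef he
    hsum1 hsum2 hsum3 hcapx hcapx' hK hFa0 hcovU0 hCKx

/-- **The assembly** (registered stub `stub_assembly` of line `Ideator3Sketch`): from the
prime-pair tail, the Mertens window, the termwise near-pair covariance bound, the pair bookkeeping
and the decorrelated covariance bound to `E s_f − Var s_f ≤ C` for `x ≥ 256`, for every
Bateman–Horn system.  Variance of `s_f = A_z + B` split at the prime powers `≤ z = ⌊√x⌋`; pair
expansion of `E A_z − Var A_z` and of `Cov(A_z, A_x − A_z)`; `E B = O(1)`; and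
`Cov(A_z, N) = Cov(A_z − A_y, N) + λ Cov(M_y, N) + Cov(W, N)` with the first two `≥ −O(1)` by
positivity and Mertens. -/
theorem stub_assembly :
    (∃ C : ℝ, ∀ x : ℕ, 2 ≤ x →
      ∑ q ∈ Nat.primesLE (Nat.sqrt x) ∪
          ((Nat.primesLE (Nat.sqrt x)).filter (fun p => p ^ 2 ≤ Nat.sqrt x)).image (fun p => p ^ 2),
        ∑ q' ∈ (Nat.primesLE x ∪ ((Nat.primesLE x).filter (fun p => p ^ 2 ≤ x)).image (fun p => p ^ 2)).filter
            (fun q' => x < q * q'),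
          (1 : ℝ) / ((q : ℝ) * (q' : ℝ)) ≤ C) →
    (∃ C : ℝ, ∀ t x : ℕ, 2 ≤ t → t ≤ x →
      ∑ p ∈ (Nat.primesLE x).filter (fun p => t < p), (1 : ℝ) / (p : ℝ) ≤
        (Real.log x - Real.log t + C) / Real.log t) →
    (∀ (g₁ g₂ : ℤ[X]), Irreducible g₁ → 0 < g₁.natDegree → 0 < g₁.leadingCoeff →
      Irreducible g₂ → 0 < g₂.natDegree → 0 < g₂.leadingCoeff →
      ∃ C : ℝ, ∀ (x q₁ q₂ : ℕ), IsPrimePow q₁ → IsPrimePow q₂ → Nat.Coprime q₁ q₂ →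
        (#((Finset.range (x + 1)).filter fun n : ℕ =>
              q₁ ∣ (g₁.eval (n : ℤ)).toNat ∧ (g₁.eval (n : ℤ)).toNat ≠ 0) : ℝ) / ((x : ℝ) + 1) *
            ((#((Finset.range (x + 1)).filter fun n : ℕ =>
              q₂ ∣ (g₂.eval (n : ℤ)).toNat ∧ (g₂.eval (n : ℤ)).toNat ≠ 0) : ℝ) / ((x : ℝ) + 1)) -
          (#((Finset.range (x + 1)).filter fun n : ℕ =>
              (q₁ ∣ (g₁.eval (n : ℤ)).toNat ∧ (g₁.eval (n : ℤ)).toNat ≠ 0) ∧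
                (q₂ ∣ (g₂.eval (n : ℤ)).toNat ∧ (g₂.eval (n : ℤ)).toNat ≠ 0)) : ℝ) / ((x : ℝ) + 1) ≤
          C / ((x : ℝ) + 1)) →
    (∀ x : ℕ,
      #(((Nat.primesLE x ∪ ((Nat.primesLE x).filter (fun p => p ^ 2 ≤ x)).image (fun p => p ^ 2)) ×ˢ
            (Nat.primesLE x ∪ ((Nat.primesLE x).filter (fun p => p ^ 2 ≤ x)).image (fun p => p ^ 2))).filter
          (fun qq : ℕ × ℕ => Nat.Coprime qq.1 qq.2 ∧ qq.1 * qq.2 ≤ x)) ≤ 2 * (x + 1) ∧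
      ∑ qq ∈ ((Nat.primesLE x ∪ ((Nat.primesLE x).filter (fun p => p ^ 2 ≤ x)).image (fun p => p ^ 2)) ×ˢ
            (Nat.primesLE x ∪ ((Nat.primesLE x).filter (fun p => p ^ 2 ≤ x)).image (fun p => p ^ 2))).filter
          (fun qq : ℕ × ℕ => ¬ Nat.Coprime qq.1 qq.2),
        (1 : ℝ) / ((qq.1 : ℝ) * (qq.2 : ℝ)) ≤ 8) →
    (∀ (k : ℕ) (f : Fin k → ℤ[X]), IsBatemanHornSystem f → ∃ C : ℝ, ∀ x : ℕ, 16 ≤ x →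
      -C ≤
        (∑ n ∈ Finset.range (x + 1),
            (∑ i, ∑ q ∈ (Nat.primesLE (Nat.sqrt (Nat.sqrt x)) ∪
                ((Nat.primesLE (Nat.sqrt (Nat.sqrt x))).filter
                  (fun p => p ^ 2 ≤ Nat.sqrt (Nat.sqrt x))).image (fun p => p ^ 2)).filter
                (fun q => q ∣ ((f i).eval (n : ℤ)).toNat ∧ ((f i).eval (n : ℤ)).toNat ≠ 0),
              (1 - 2 * ArithmeticFunction.vonMangoldt q / Real.log (Nat.sqrt (Nat.sqrt x)))) *
            (((∑ i, (((f i).eval (n : ℤ)).toNat.factorization.sum fun _ v => min v 2) : ℕ) : ℝ) -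
              ((∑ i, #((Nat.primesLE x ∪ ((Nat.primesLE x).filter (fun p => p ^ 2 ≤ x)).image
                  (fun p => p ^ 2)).filter
                (fun q => q ∣ ((f i).eval (n : ℤ)).toNat ∧ ((f i).eval (n : ℤ)).toNat ≠ 0)) : ℕ) : ℝ))) /
            ((x : ℝ) + 1) -
          (∑ n ∈ Finset.range (x + 1),
              (∑ i, ∑ q ∈ (Nat.primesLE (Nat.sqrt (Nat.sqrt x)) ∪
                  ((Nat.primesLE (Nat.sqrt (Nat.sqrt x))).filter
                    (fun p => p ^ 2 ≤ Nat.sqrt (Nat.sqrt x))).image (fun p => p ^ 2)).filter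
                  (fun q => q ∣ ((f i).eval (n : ℤ)).toNat ∧ ((f i).eval (n : ℤ)).toNat ≠ 0),
                (1 - 2 * ArithmeticFunction.vonMangoldt q / Real.log (Nat.sqrt (Nat.sqrt x))))) /
              ((x : ℝ) + 1) *
            ((∑ n ∈ Finset.range (x + 1),
                (((∑ i, (((f i).eval (n : ℤ)).toNat.factorization.sum fun _ v => min v 2) : ℕ) : ℝ) -
                  ((∑ i, #((Nat.primesLE x ∪ ((Nat.primesLE x).filter (fun p => p ^ 2 ≤ x)).image
                      (fun p => p ^ 2)).filter
                    (fun q => q ∣ ((f i).eval (n : ℤ)).toNat ∧ ((f i).eval (n : ℤ)).toNat ≠ 0)) : ℕ) :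
                    ℝ))) /
              ((x : ℝ) + 1))) →
    ∀ (k : ℕ) (f : Fin k → ℤ[X]), IsBatemanHornSystem f → ∃ C : ℝ, ∀ x : ℕ, 256 ≤ x →
      ((∑ n ∈ Finset.range (x + 1), ∑ i, (((f i).eval (n : ℤ)).toNat.factorization.sum
          fun _ v => min v 2) : ℕ) : ℝ) / ((x : ℝ) + 1) -
        (((∑ n ∈ Finset.range (x + 1), (∑ i, (((f i).eval (n : ℤ)).toNat.factorization.sum
            fun _ v => min v 2)) ^ 2 : ℕ) : ℝ) / ((x : ℝ) + 1) -
          (((∑ n ∈ Finset.range (x + 1), ∑ i, (((f i).eval (n : ℤ)).toNat.factorization.sum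
              fun _ v => min v 2) : ℕ) : ℝ) / ((x : ℝ) + 1)) ^ 2) ≤ C :=
  fun hS2 hS2' hS3a hS3c hK1 k f hf => assembly_local hS2 hS2' hS3a hS3c k f hf (hK1 k f hf)

end Summit.Parity.BatemanHorn.Cruxes.SystemMomentDeficit.Ideator3Sketch
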